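import Literature.Barriers.RiemannHypothesis.JensenPolynomialsProofs
import Literature.NumberTheory.LFunctions.EquivalentsJensenProofs
import Literature.Analysis.Complex.JensenPolynomialHyperbolicity
import Mathlib.Analysis.SpecialFunctions.Trigonometric.Series
import Mathlib.Analysis.Analytic.OfScalars
import HarnessLib

/-!
# Barrier `JensenPolynomialsShiftUniform`: Hermite universality plus shift-uniform hyperbolicity
# up to any fixed degree still carries no information on full hyperbolicity (Farmer 2022, §4,
# the `X_{10}` phenomenon, made rigorous with an explicit genus-zero witness)

Barrier catalogue `Literature/Barriers/RiemannHypothesis/` (D-0021); third sibling of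
`JensenPolynomials.lean` (audit 2026-08-16). The entry `JensenPolynomials` (witness `(1+z²)eᶻ`, Kim's
class) and its sharpening `JensenPolynomialsNarrow` (`JensenPolynomialsProofs.lean`: `γ` with one
coefficient changed — the Hermite-universality class proper) leave one kind of Jensen data
un-neutralised: SHIFT-UNIFORM hyperbolicity at bounded degree, "`J^{d,n}` hyperbolic for ALL `n` and
all `d ≤ D`" (for `γ`: `d ≤ 3` Csordas–Norfolk–Varga / Dimitrov–Lucas, `d ≤ 8` GORZ Thm. 2,
`d ≤ 64` the tree's `jensenPoly_xiTaylorCoeff_splits_of_le`, `4d ≤ T²` from RH to height `T`,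
Kim–Lee Thm. 4 / Chasse). Farmer's answer (§4) is the function `X_{10}` — all `J^{d,n}`, `n ≥ 1`,
and all `J^{d,0}`, `d ≤ 118`, hyperbolic, "RH" false — read off a graph. This file PROVES the
corresponding statement for every `D`:

**`JensenPolynomialsShiftUniform`** (proved, `JensenPolynomialsShiftUniform_holds`): for every
`D ≥ 1` there is a real entire function `F` of order `< 1` with real Taylor coefficients
`a(k) = F⁽ᵏ⁾(0) > 0`, a non-real zero, and all zeros in the cone `|Im w| ≤ -Re w/√D`, such that
* `a` satisfies GORZ's Hermite-universality hypotheses §5.1 (15) for EVERY degree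
  (`HasGORZExpansion a`), hence is `EventuallyHyperbolic` (GORZ Thm. 3/6 + Corollary);
* `J^{d,n}_a` is hyperbolic for EVERY shift `n ≥ 0` and every degree `d ≤ D` (Turán, higher Turán,
  … up to degree `D`, at all shifts);
* and yet `a` is not `AllHyperbolic` (some `J^{d,0}_a` has non-real zeros).

So no inference "(15) for all degrees + hyperbolicity for all large shifts + hyperbolicity for all
shifts up to degree `D` ⟹ all Jensen polynomials hyperbolic" is valid, for any `D`; for
`γ = xiTaylorCoeff` the conclusion is RH (Pólya) and the premises are theorems (GORZ Thm. 1,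
unconditional in the tree; `d ≤ 64` unconditional; `d ≤ 9·10²⁴` from Platt–Trudgian).

## The witness (`ConeWitness`)

`F_ε(w) = ((w+1)² + ε)·G(w)` with `G(w) = ∑ w^m/(2m)!` (`G(z²) = cosh z`; zeros `-((2k+1)π/2)²`) and
`ε = 1/D`: the extra zeros are `-1 ± i√ε`, inside the convex cone `K = {|Im w| ≤ -√ε Re w} ⊆ S(√ε)`.
* `ConeWitness.splits_jensenPoly_aSeq`: all-shift hyperbolicity for `d ε ≤ 1`, by the tree's
  `Literature.NumberTheory.LFunctions.splits_jensenPoly_taylor_of_zeros_mem_convex` (Kim–Lee Thm. 4 /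
  Obreschkoff / Gauss–Lucas / Hadamard in genus zero).
* `ConeWitness.not_forall_splits_jensenPoly_aSeq`: not all `J^{d,0}` hyperbolic, by the tree's
  `PolyaSchur.im_eq_zero_of_forall_splits_jensenPoly` (Craven–Csordas Lemma 2.2 + Hurwitz) and the
  zero `-1 + i√ε`.
* `ConeWitness.hasGORZExpansion_aSeq`: universality. The Taylor sequence is
  `a_ε(m) = m!·c_m = (m!/(2m)!)·ρ_ε(m)`, `ρ_ε(m) = 16m⁴ - 48m³ + 52m² - 16m + 1 + ε`
  (`aSeq_eq`), so `log(a(n+j)/a(n)) = -j log 4 - ∑_{k<j} log(n+k+½) + log(1 + E_n(j))` with the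
  rational, NEGLIGIBLE family `E_n(j) = (ρ_ε(n+j) - ρ_ε(n))/ρ_ε(n)` (`isNegl_Eρ`: coefficient of
  `jⁱ` is `O(n^{-i}) = o(δ₀^i)`), and the general form of GORZ §5.1 Steps C–E
  (`hasGORZExpansion_of_factorialLogRatio`, reusing the tree's `GORZAsymp` bookkeeping from
  `JensenAsymptotics.lean`: `IsNegl`, `logPoly`, `Wpoly`, `isLittleO_sum_log_sub`) gives (15) for
  every degree, exactly as for `γ` (where `L(n) = 2 log ū_{2n}` and `E` comes from the moments of
  `Φ`).
* Analytic bookkeeping: `coshSq` as `FormalMultilinearSeries.ofScalarsSum` (infinite radius by the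
  ratio test), `hasSum_fCoeff` (Cauchy product with the quadratic by index shifts),
  `iteratedDeriv_F_zero` (`HasFPowerSeriesOnBall.factorial_smul`), growth
  `‖F_ε(w)‖ ≤ (50+|ε|)e⁸ exp(‖w‖^{3/4})`.

No named facts; standard axioms.

## References

* [Farmer2022] D. W. Farmer, *Jensen polynomials are not a plausible route to proving the Riemann
  hypothesis*, Adv. Math. 411 (2022), 108781 = arXiv:2008.07206, §4 (`X_{10}`; read, p. 6).
* [GORZPNAS2019] M. Griffin, K. Ono, L. Rolen, D. Zagier, PNAS 116 (2019), Thm. 3, Thm. 6, §5.1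
  eq. (15) (read, pp. 3, 6, 10).
* [KimLee2021] Y.-O. Kim, J. Lee, arXiv:2105.05386, Thm. 4 and Remark.
* [CravenCsordas1989] T. Craven, G. Csordas, Pacific J. Math. 136 (1989), §1 (i), Lemma 2.2.
-/

noncomputable section

open Filter Topology Asymptotics Polynomial Finset Complex
open scoped Nat ComplexConjugate Real

namespace Literature.Barriers.RiemannHypothesis

open Literature.NumberTheory.LFunctions Literature.Analysis.TotalPositivity
  Literature.Analysis.Complex Literature.Analysis.Complex.PolyaSchur

namespace ConeWitness

/-! ### The entire function `G(w) = cosh √w = ∑ w^m/(2m)!` -/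

/-- Taylor coefficients `g_m = 1/(2m)!` of `G(w) = cosh √w`. [folklore] -/
def coshCoeff (m : ℕ) : ℂ := ((2 * m)! : ℂ)⁻¹

/-- `G(w) = ∑ w^m/(2m)!`, the entire function with `G(z²) = cosh z`. [folklore] -/
def coshSq : ℂ → ℂ := FormalMultilinearSeries.ofScalarsSum (E := ℂ) coshCoeff

/-- `g_m ≠ 0`. [folklore] -/
theorem coshCoeff_ne_zero (m : ℕ) : coshCoeff m ≠ 0 :=
  inv_ne_zero (by exact_mod_cast (2 * m).factorial_ne_zero)

/-- `‖g_m‖ = 1/(2m)!`. [folklore] -/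
theorem norm_coshCoeff (m : ℕ) : ‖coshCoeff m‖ = ((2 * m)! : ℝ)⁻¹ := by
  rw [coshCoeff, norm_inv, Complex.norm_natCast]

/-- `g_m` is real. [folklore] -/
theorem coshCoeff_eq_ofReal (m : ℕ) : coshCoeff m = ((((2 * m)! : ℝ)⁻¹ : ℝ) : ℂ) := by
  rw [coshCoeff]; push_cast; rfl

/-- The ratio `‖g_{m+1}‖/‖g_m‖ = 1/((2m+1)(2m+2))` (for the ratio test). [folklore] -/
theorem norm_coshCoeff_succ_div (n : ℕ) :
    ‖coshCoeff (n + 1)‖ / ‖coshCoeff n‖ = 1 / ((2 * n + 1) * (2 * n + 2) : ℝ) := by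
  rw [norm_coshCoeff, norm_coshCoeff]
  have h : ((2 * (n + 1))! : ℝ) = (2 * n + 2) * (2 * n + 1) * (2 * n)! := by
    rw [show 2 * (n + 1) = (2 * n + 1) + 1 by ring, Nat.factorial_succ, Nat.factorial_succ]
    push_cast; ring
  rw [h]
  have h0 : ((2 * n)! : ℝ) ≠ 0 := by positivity
  field_simp

/-- The power series of `G` has infinite radius of convergence (ratio test). [folklore] -/
theorem coshSq_radius_eq_top : (FormalMultilinearSeries.ofScalars ℂ coshCoeff).radius = ⊤ := by
  refine FormalMultilinearSeries.ofScalars_radius_eq_top_of_tendsto ℂ coshCoeff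
    (Eventually.of_forall coshCoeff_ne_zero) ?_
  have h : ∀ n : ℕ, ‖coshCoeff n.succ‖ / ‖coshCoeff n‖ = 1 / ((2 * n + 1) * (2 * n + 2) : ℝ) :=
    norm_coshCoeff_succ_div
  simp only [h]
  refine squeeze_zero (fun n => by positivity) (fun n => ?_) tendsto_one_div_add_atTop_nhds_zero_nat
  rw [div_le_div_iff₀ (by positivity) (by positivity), one_mul, one_mul]
  nlinarith [(Nat.cast_nonneg n : (0 : ℝ) ≤ n)]

/-- `G` is the sum of its power series on all of `ℂ`. [folklore] -/
theorem hasFPowerSeriesOnBall_coshSq :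
    HasFPowerSeriesOnBall coshSq (FormalMultilinearSeries.ofScalars ℂ coshCoeff) 0 ⊤ := by
  have h := (FormalMultilinearSeries.ofScalars ℂ coshCoeff).hasFPowerSeriesOnBall
    (by rw [coshSq_radius_eq_top]; exact ENNReal.zero_lt_top)
  rw [coshSq_radius_eq_top] at h
  exact h

/-- `G` is entire. [folklore] -/
theorem differentiable_coshSq : Differentiable ℂ coshSq := fun z =>
  (hasFPowerSeriesOnBall_coshSq.analyticAt_of_mem
    (by rw [Metric.mem_eball]; exact edist_lt_top z 0)).differentiableAt

/-- `G(w) = ∑ g_m w^m`. [folklore] -/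
theorem hasSum_coshCoeff (w : ℂ) : HasSum (fun m => coshCoeff m * w ^ m) (coshSq w) := by
  have h := hasFPowerSeriesOnBall_coshSq.hasSum (y := w)
    (by rw [Metric.mem_eball]; exact edist_lt_top w 0)
  rw [zero_add] at h
  simpa only [FormalMultilinearSeries.ofScalars_apply_eq, smul_eq_mul] using h

/-- `G(z²) = cosh z`. [folklore] -/
theorem coshSq_sq (z : ℂ) : coshSq (z ^ 2) = Complex.cosh z := by
  refine (hasSum_coshCoeff (z ^ 2)).unique ?_
  refine (Complex.hasSum_cosh z).congr_fun fun m => ?_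
  rw [coshCoeff, ← pow_mul, div_eq_mul_inv, mul_comm]

/-- `G(0) = 1`. [folklore] -/
theorem coshSq_zero : coshSq 0 = 1 := by
  rw [coshSq, FormalMultilinearSeries.ofScalarsSum_zero, coshCoeff]; simp

/-- The zeros of `G` are the numbers `-((2k+1)π/2)²`; in particular real and `≤ 0`. [folklore] -/
theorem im_eq_zero_and_re_nonpos_of_coshSq_eq_zero {w : ℂ} (hw : coshSq w = 0) :
    w.im = 0 ∧ w.re ≤ 0 := by
  set u := w ^ (2⁻¹ : ℂ) with hu
  have hu2 : u ^ 2 = w := Complex.cpow_nat_inv_pow w two_ne_zero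
  rw [← hu2, coshSq_sq, ← Complex.cos_mul_I] at hw
  obtain ⟨k, hk⟩ := Complex.cos_eq_zero_iff.1 hw
  have huI : u = (2 * k + 1) * π / 2 * (-I) := by
    have : u = u * I * (-I) := by rw [mul_assoc, mul_neg, I_mul_I, neg_neg, mul_one]
    rw [this, hk]
  have hw' : w = -((((2 * k + 1) * Real.pi / 2) ^ 2 : ℝ) : ℂ) := by
    rw [← hu2, huI]; push_cast; ring_nf; rw [I_sq]; ring
  rw [hw']
  simp only [neg_im, ofReal_im, neg_zero, neg_re, ofReal_re, Left.neg_nonpos_iff, true_and]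
  positivity

/-- `‖G(w)‖ ≤ cosh √‖w‖ ≤ exp √‖w‖`. [folklore] -/
theorem norm_coshSq_le (w : ℂ) : ‖coshSq w‖ ≤ Real.exp (Real.sqrt ‖w‖) := by
  have h1 := hasSum_coshCoeff w
  have h2 : HasSum (fun m => ‖w‖ ^ m / ((2 * m)! : ℝ)) (Real.cosh (Real.sqrt ‖w‖)) := by
    refine (Real.hasSum_cosh (Real.sqrt ‖w‖)).congr_fun fun m => ?_
    rw [pow_mul, Real.sq_sqrt (norm_nonneg _)]
  have h3 : ‖coshSq w‖ ≤ Real.cosh (Real.sqrt ‖w‖) := by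
    refine h1.norm_le_of_bounded h2 fun m => ?_
    rw [norm_mul, norm_pow, norm_coshCoeff, div_eq_inv_mul]
  refine h3.trans ?_
  rw [Real.cosh_eq]
  have : Real.exp (-Real.sqrt ‖w‖) ≤ Real.exp (Real.sqrt ‖w‖) :=
    Real.exp_le_exp.2 (by linarith [Real.sqrt_nonneg ‖w‖])
  linarith

/-- `g_m` is fixed by conjugation. [folklore] -/
theorem conj_coshCoeff (m : ℕ) : conj (coshCoeff m) = coshCoeff m := by
  rw [coshCoeff_eq_ofReal, Complex.conj_ofReal]

/-- `G(w̄) = conj G(w)` (real Taylor coefficients). [folklore] -/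
theorem coshSq_conj (w : ℂ) : coshSq (conj w) = conj (coshSq w) := by
  have h1 := (hasSum_coshCoeff w).map (starRingEnd ℂ) continuous_conj
  have h2 : HasSum (fun m => coshCoeff m * (conj w) ^ m) (conj (coshSq w)) := by
    refine h1.congr_fun fun m => ?_
    simp only [Function.comp_apply, map_mul, map_pow, conj_coshCoeff]
  exact (hasSum_coshCoeff (conj w)).unique h2

/-! ### The witness function `F_ε(w) = ((w+1)² + ε) · G(w)` and its Taylor coefficients -/

/-- Coefficients of the shifted series `w·G(w)`: `g_{m-1}` (`0` for `m = 0`). [folklore] -/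
def coshCoeff₁ (m : ℕ) : ℂ := if m = 0 then 0 else coshCoeff (m - 1)

/-- Coefficients of `w²·G(w)`: `g_{m-2}` (`0` for `m ≤ 1`). [folklore] -/
def coshCoeff₂ (m : ℕ) : ℂ := if m < 2 then 0 else coshCoeff (m - 2)

/-- Taylor coefficients of `F_ε`: `c_m = (1+ε) g_m + 2 g_{m-1} + g_{m-2}`. [folklore] -/
def fCoeff (ε : ℝ) (m : ℕ) : ℂ := (1 + ε) * coshCoeff m + 2 * coshCoeff₁ m + coshCoeff₂ m

/-- The witness `F_ε(w) = ((w + 1)² + ε) G(w)`: real entire of order `½`, zeros = the negative reals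
`-((2k+1)π/2)²` and the pair `-1 ± i√ε`. [folklore] -/
def F (ε : ℝ) (w : ℂ) : ℂ := ((w + 1) ^ 2 + ε) * coshSq w

/-- `g_{-1} = 0`. [folklore] -/
theorem coshCoeff₁_zero : coshCoeff₁ 0 = 0 := by simp [coshCoeff₁]

/-- The shifted coefficient at `m + 1` is `g_m`. [folklore] -/
theorem coshCoeff₁_succ (m : ℕ) : coshCoeff₁ (m + 1) = coshCoeff m := by
  simp [coshCoeff₁]

/-- `g_{-2} = 0`. [folklore] -/
theorem coshCoeff₂_zero : coshCoeff₂ 0 = 0 := by simp [coshCoeff₂]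

/-- `g_{-1} = 0` (second shift). [folklore] -/
theorem coshCoeff₂_one : coshCoeff₂ 1 = 0 := by simp [coshCoeff₂]

/-- The twice-shifted coefficient at `m + 2` is `g_m`. [folklore] -/
theorem coshCoeff₂_add_two (m : ℕ) : coshCoeff₂ (m + 2) = coshCoeff m := by
  simp [coshCoeff₂]

/-- `F_ε(w) = ∑ c_m w^m` (Cauchy product with the quadratic, by index shifts). [folklore] -/
theorem hasSum_fCoeff (ε : ℝ) (w : ℂ) : HasSum (fun m => fCoeff ε m * w ^ m) (F ε w) := by
  have h0 := (hasSum_coshCoeff w).mul_left ((1 : ℂ) + ε)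
  have h1 : HasSum (fun m => coshCoeff₁ m * w ^ m) (w * coshSq w) := by
    have hz : w * coshSq w = w * coshSq w + ∑ i ∈ range 1, coshCoeff₁ i * w ^ i := by
      rw [sum_range_one, coshCoeff₁_zero, zero_mul, add_zero]
    rw [hz]
    refine (hasSum_nat_add_iff (f := fun m => coshCoeff₁ m * w ^ m) 1).1 ?_
    show HasSum (fun m => coshCoeff₁ (m + 1) * w ^ (m + 1)) (w * coshSq w)
    refine ((hasSum_coshCoeff w).mul_left w).congr_fun fun m => ?_
    rw [coshCoeff₁_succ, pow_succ]; ring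
  have h2 : HasSum (fun m => coshCoeff₂ m * w ^ m) (w ^ 2 * coshSq w) := by
    have hz : w ^ 2 * coshSq w = w ^ 2 * coshSq w + ∑ i ∈ range 2, coshCoeff₂ i * w ^ i := by
      rw [sum_range_succ, sum_range_one, coshCoeff₂_zero, coshCoeff₂_one, zero_mul, zero_mul,
        add_zero, add_zero]
    rw [hz]
    refine (hasSum_nat_add_iff (f := fun m => coshCoeff₂ m * w ^ m) 2).1 ?_
    show HasSum (fun m => coshCoeff₂ (m + 2) * w ^ (m + 2)) (w ^ 2 * coshSq w)
    refine ((hasSum_coshCoeff w).mul_left (w ^ 2)).congr_fun fun m => ?_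
    rw [coshCoeff₂_add_two, pow_add]; ring
  have key := (h0.add (h1.mul_left 2)).add h2
  have hval : F ε w = (1 + (ε : ℂ)) * coshSq w + 2 * (w * coshSq w) + w ^ 2 * coshSq w := by
    rw [F]; ring
  rw [hval]
  refine key.congr_fun fun m => ?_
  simp only [fCoeff]; ring

/-! ### `F_ε` as a power series: radius, Taylor coefficients, realness -/

/-- Real form of the coefficients `g_m`. [folklore] -/
def coshCoeffR (m : ℕ) : ℝ := ((2 * m)! : ℝ)⁻¹

/-- Real form of the coefficients `c_m`. [folklore] -/
def fCoeffR (ε : ℝ) (m : ℕ) : ℝ :=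
  (1 + ε) * coshCoeffR m + 2 * (if m = 0 then 0 else coshCoeffR (m - 1)) +
    (if m < 2 then 0 else coshCoeffR (m - 2))

/-- `g_m` as a real number. [folklore] -/
theorem coshCoeff_eq (m : ℕ) : coshCoeff m = (coshCoeffR m : ℂ) := by
  rw [coshCoeff, coshCoeffR]; push_cast; rfl

/-- The shifted coefficients are real. [folklore] -/
theorem coshCoeff₁_eq (m : ℕ) :
    coshCoeff₁ m = ((if m = 0 then 0 else coshCoeffR (m - 1) : ℝ) : ℂ) := by
  unfold coshCoeff₁; split_ifs <;> simp [coshCoeff_eq]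

/-- The twice-shifted coefficients are real. [folklore] -/
theorem coshCoeff₂_eq (m : ℕ) :
    coshCoeff₂ m = ((if m < 2 then 0 else coshCoeffR (m - 2) : ℝ) : ℂ) := by
  unfold coshCoeff₂; split_ifs <;> simp [coshCoeff_eq]

/-- `c_m` is real. [folklore] -/
theorem fCoeff_eq (ε : ℝ) (m : ℕ) : fCoeff ε m = (fCoeffR ε m : ℂ) := by
  rw [fCoeff, fCoeffR, coshCoeff_eq, coshCoeff₁_eq, coshCoeff₂_eq]; push_cast; ring

/-- `g_m > 0`. [folklore] -/
theorem coshCoeffR_pos (m : ℕ) : 0 < coshCoeffR m := by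
  rw [coshCoeffR]; positivity

/-- `c_m > 0` for `ε ≥ 0`. [folklore] -/
theorem fCoeffR_pos {ε : ℝ} (hε : 0 ≤ ε) (m : ℕ) : 0 < fCoeffR ε m := by
  rw [fCoeffR]
  have h1 : 0 < (1 + ε) * coshCoeffR m := mul_pos (by linarith) (coshCoeffR_pos m)
  have h2 : 0 ≤ (2 : ℝ) * (if m = 0 then 0 else coshCoeffR (m - 1)) := by
    split_ifs
    · simp
    · exact mul_nonneg two_pos.le (coshCoeffR_pos _).le
  have h3 : (0 : ℝ) ≤ (if m < 2 then 0 else coshCoeffR (m - 2)) := by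
    split_ifs
    · exact le_rfl
    · exact (coshCoeffR_pos _).le
  linarith

/-- The power series `∑ c_m w^m` has infinite radius of convergence (its terms at any real `r` tend to `0`). [folklore] -/
theorem fCoeff_radius_eq_top (ε : ℝ) :
    (FormalMultilinearSeries.ofScalars ℂ (fCoeff ε)).radius = ⊤ := by
  refine ENNReal.eq_top_of_forall_nnreal_le fun r ↦ ?_
  have hs : Summable fun n : ℕ ↦ fCoeff ε n * ((r : ℂ)) ^ n := (hasSum_fCoeff ε r).summable
  obtain ⟨C, hC⟩ := (hs.tendsto_atTop_zero.norm).isBoundedUnder_le |>.imp fun C h ↦ h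
  simp only [eventually_map, eventually_atTop] at hC
  obtain ⟨M, hM⟩ := hC
  set C' : ℝ := max C (Finset.sup' (Finset.range (M + 1)) (by simp)
    fun n ↦ ‖fCoeff ε n * (r : ℂ) ^ n‖) with hC'
  refine FormalMultilinearSeries.le_radius_of_bound _ C' fun n ↦ ?_
  have hnorm : ‖FormalMultilinearSeries.ofScalars ℂ (fCoeff ε) n‖ * (r : ℝ) ^ n =
      ‖fCoeff ε n * (r : ℂ) ^ n‖ := by
    rw [FormalMultilinearSeries.ofScalars_norm, norm_mul, norm_pow, Complex.norm_real,
      Real.norm_eq_abs, NNReal.abs_eq]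
  rw [hnorm]
  rcases le_or_gt M n with h | h
  · exact (hM n h).trans (le_max_left _ _)
  · refine le_trans ?_ (le_max_right _ _)
    exact Finset.le_sup' (fun n ↦ ‖fCoeff ε n * (r : ℂ) ^ n‖) (by simp; omega)

/-- `F_ε` is the sum of the power series `∑ c_m w^m`. [folklore] -/
theorem ofScalarsSum_fCoeff (ε : ℝ) :
    FormalMultilinearSeries.ofScalarsSum (E := ℂ) (fCoeff ε) = F ε := by
  funext w
  rw [FormalMultilinearSeries.ofScalars_sum_eq]
  simp only [smul_eq_mul]
  exact (hasSum_fCoeff ε w).tsum_eq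

/-- `F_ε` has the power series `∑ c_m w^m` at `0` on all of `ℂ`. [folklore] -/
theorem hasFPowerSeriesOnBall_F (ε : ℝ) :
    HasFPowerSeriesOnBall (F ε) (FormalMultilinearSeries.ofScalars ℂ (fCoeff ε)) 0 ⊤ := by
  have hrad := fCoeff_radius_eq_top ε
  have h := (FormalMultilinearSeries.ofScalars ℂ (fCoeff ε)).hasFPowerSeriesOnBall
    (by rw [hrad]; exact ENNReal.zero_lt_top)
  rw [hrad] at h
  have h' : HasFPowerSeriesOnBall (FormalMultilinearSeries.ofScalarsSum (E := ℂ) (fCoeff ε))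
      (FormalMultilinearSeries.ofScalars ℂ (fCoeff ε)) 0 ⊤ := h
  rwa [ofScalarsSum_fCoeff] at h'

/-- Taylor coefficients of `F_ε` at `0`: `F_ε⁽ⁿ⁾(0) = n! c_n`. [folklore] -/
theorem iteratedDeriv_F_zero (ε : ℝ) (n : ℕ) :
    iteratedDeriv n (F ε) 0 = (n ! : ℂ) * fCoeff ε n := by
  have h := (hasFPowerSeriesOnBall_F ε).factorial_smul 1 n
  rw [iteratedDeriv_eq_iteratedFDeriv, ← h, FormalMultilinearSeries.ofScalars_apply_eq]
  simp [nsmul_eq_mul]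

/-- The Taylor sequence `a_ε(n) = F_ε⁽ⁿ⁾(0) = n! c_n` (real). [folklore] -/
def aSeq (ε : ℝ) (n : ℕ) : ℝ := (n ! : ℝ) * fCoeffR ε n

/-- `Re F_ε⁽ⁿ⁾(0) = a_ε(n)`. [folklore] -/
theorem re_iteratedDeriv_F (ε : ℝ) (n : ℕ) : (iteratedDeriv n (F ε) 0).re = aSeq ε n := by
  rw [iteratedDeriv_F_zero, fCoeff_eq, ← Complex.ofReal_natCast, ← Complex.ofReal_mul,
    Complex.ofReal_re, aSeq]

/-- The Taylor sequence of `F_ε` is `a_ε`. [folklore] -/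
theorem taylorSeq_F_eq (ε : ℝ) : (fun n => (iteratedDeriv n (F ε) 0).re) = aSeq ε :=
  funext (re_iteratedDeriv_F ε)

/-- `a_ε(n) > 0` for `ε ≥ 0`. [folklore] -/
theorem aSeq_pos {ε : ℝ} (hε : 0 ≤ ε) (n : ℕ) : 0 < aSeq ε n :=
  mul_pos (by positivity) (fCoeffR_pos hε n)

/-! ### `F_ε`: entire of order `< 1`, real, zeros in a thin cone, one non-real zero -/

/-- `F_ε` is entire. [folklore] -/
theorem differentiable_F (ε : ℝ) : Differentiable ℂ (F ε) :=
  (((differentiable_id.add_const 1).pow 2).add_const _).mul differentiable_coshSq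

/-- `F_ε(w̄) = conj F_ε(w)`. [folklore] -/
theorem F_conj (ε : ℝ) (w : ℂ) : F ε (conj w) = conj (F ε w) := by
  rw [F, F, coshSq_conj]
  simp [map_add, map_mul, map_pow, Complex.conj_ofReal]

/-- `F_ε(0) = 1 + ε`. [folklore] -/
theorem F_apply_zero (ε : ℝ) : F ε 0 = 1 + ε := by
  rw [F, coshSq_zero]; ring

/-- `F_ε(0) ≠ 0` for `ε ≥ 0`. [folklore] -/
theorem F_zero_ne {ε : ℝ} (hε : 0 ≤ ε) : F ε 0 ≠ 0 := by
  rw [F_apply_zero, ← Complex.ofReal_one, ← Complex.ofReal_add, Complex.ofReal_ne_zero]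
  linarith

/-- Growth: `‖F_ε(w)‖ ≤ (50 + |ε|) e⁸ · exp(‖w‖^{3/4})` (order `½ < 1`). [folklore] -/
theorem norm_F_le (ε : ℝ) (w : ℂ) :
    ‖F ε w‖ ≤ (50 + |ε|) * Real.exp 8 * Real.exp (‖w‖ ^ (3 / 4 : ℝ)) := by
  set s : ℝ := Real.sqrt ‖w‖ with hs
  have hs0 : 0 ≤ s := Real.sqrt_nonneg _
  have hsq : ‖w‖ = s ^ 2 := (Real.sq_sqrt (norm_nonneg w)).symm
  have hexp1 : 1 ≤ Real.exp s := Real.one_le_exp hs0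
  have h4 : s ^ 4 ≤ 24 * Real.exp s := by
    have := Real.pow_div_factorial_le_exp s hs0 4
    rw [show ((4 : ℕ)! : ℝ) = 24 by norm_num [Nat.factorial], div_le_iff₀ (by norm_num)] at this
    linarith
  have h2 : s ^ 2 ≤ 2 * Real.exp s := by
    have := Real.pow_div_factorial_le_exp s hs0 2
    rw [show ((2 : ℕ)! : ℝ) = 2 by norm_num [Nat.factorial], div_le_iff₀ (by norm_num)] at this
    linarith
  have hε' : |ε| ≤ |ε| * Real.exp s := le_mul_of_one_le_right (abs_nonneg ε) hexp1
  have hQ : ‖(w + 1) ^ 2 + (ε : ℂ)‖ ≤ (50 + |ε|) * Real.exp s := by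
    calc ‖(w + 1) ^ 2 + (ε : ℂ)‖ ≤ ‖(w + 1) ^ 2‖ + ‖(ε : ℂ)‖ := norm_add_le _ _
      _ = ‖w + 1‖ ^ 2 + |ε| := by rw [norm_pow, Complex.norm_real, Real.norm_eq_abs]
      _ ≤ (‖w‖ + 1) ^ 2 + |ε| := by
          gcongr; exact (norm_add_le _ _).trans (by simp)
      _ = (s ^ 2 + 1) ^ 2 + |ε| := by rw [hsq]
      _ ≤ (50 + |ε|) * Real.exp s := by nlinarith [abs_nonneg ε, sq_nonneg s, h4, h2, hε', hexp1]
  have hG := norm_coshSq_le w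
  rw [← hs] at hG
  have htwo : 2 * s ≤ ‖w‖ ^ (3 / 4 : ℝ) + 8 := by
    have h := two_mul_le_rpow_three_halves_add hs0
    have : s ^ (3 / 2 : ℝ) = ‖w‖ ^ (3 / 4 : ℝ) := by
      rw [hs, Real.sqrt_eq_rpow, ← Real.rpow_mul (norm_nonneg w)]; norm_num
    linarith
  calc ‖F ε w‖ = ‖(w + 1) ^ 2 + (ε : ℂ)‖ * ‖coshSq w‖ := norm_mul _ _
    _ ≤ (50 + |ε|) * Real.exp s * Real.exp s := by gcongr
    _ = (50 + |ε|) * Real.exp (2 * s) := by rw [mul_assoc, ← Real.exp_add]; ring_nf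
    _ ≤ (50 + |ε|) * Real.exp (‖w‖ ^ (3 / 4 : ℝ) + 8) := by gcongr
    _ = (50 + |ε|) * Real.exp 8 * Real.exp (‖w‖ ^ (3 / 4 : ℝ)) := by
          rw [Real.exp_add]; ring

/-- `F_ε` is entire of order `< 1` in the tree's quantitative sense (`ρ = 3/4`). [folklore] -/
theorem isEntireOfOrderLtOne_F (ε : ℝ) : IsEntireOfOrderLtOne (F ε) :=
  ⟨differentiable_F ε, 3 / 4, (50 + |ε|) * Real.exp 8, by norm_num, norm_F_le ε⟩

/-- Real part of `(w+1)² + ε`. [folklore] -/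
theorem re_quad (ε : ℝ) (w : ℂ) : ((w + 1) ^ 2 + (ε : ℂ)).re = (w.re + 1) ^ 2 - w.im ^ 2 + ε := by
  simp [sq]

/-- Imaginary part of `(w+1)² + ε`. [folklore] -/
theorem im_quad (ε : ℝ) (w : ℂ) : ((w + 1) ^ 2 + (ε : ℂ)).im = 2 * (w.re + 1) * w.im := by
  simp [sq]; ring

/-- Every zero of `F_ε` lies in the closed cone `{|Im w| ≤ -√ε · Re w}`. [folklore] -/
theorem mem_cone_of_F_eq_zero {ε : ℝ} (hε : 0 < ε) {w : ℂ} (h : F ε w = 0) :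
    w ∈ {z : ℂ | z.im + Real.sqrt ε * z.re ≤ 0 ∧ -z.im + Real.sqrt ε * z.re ≤ 0} := by
  have hsq : 0 ≤ Real.sqrt ε := Real.sqrt_nonneg ε
  rcases mul_eq_zero.1 h with hQ | hG
  · have hre := re_quad ε w
    have him := im_quad ε w
    rw [hQ, Complex.zero_re] at hre
    rw [hQ, Complex.zero_im] at him
    have hre1 : w.re = -1 := by
      rcases mul_eq_zero.1 him.symm with h1 | h1
      · rcases mul_eq_zero.1 h1 with h2 | h2
        · norm_num at h2
        · linarith
      · exfalso; rw [h1] at hre; nlinarith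
    have habs : |w.im| = Real.sqrt ε := by
      rw [← Real.sqrt_sq_eq_abs]; congr 1; rw [hre1] at hre; nlinarith
    simp only [Set.mem_setOf_eq, hre1]
    constructor <;> [have := le_abs_self w.im; have := neg_abs_le w.im] <;> linarith
  · obtain ⟨him, hre⟩ := im_eq_zero_and_re_nonpos_of_coshSq_eq_zero hG
    simp only [Set.mem_setOf_eq, him, neg_zero, zero_add]
    have : Real.sqrt ε * w.re ≤ 0 := mul_nonpos_of_nonneg_of_nonpos hsq hre
    exact ⟨this, this⟩

/-- The non-real zero `w₀ = -1 + i√ε` of `F_ε`. [folklore] -/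
def w₀ (ε : ℝ) : ℂ := -1 + Real.sqrt ε * I

/-- `F_ε(w₀) = 0`. [folklore] -/
theorem F_w₀ {ε : ℝ} (hε : 0 ≤ ε) : F ε (w₀ ε) = 0 := by
  have : (w₀ ε + 1) ^ 2 + (ε : ℂ) = 0 := by
    rw [w₀, show (-1 + (Real.sqrt ε : ℂ) * I + 1) = (Real.sqrt ε : ℂ) * I by ring, mul_pow, I_sq,
      ← Complex.ofReal_pow, Real.sq_sqrt hε]
    ring
  rw [F, this, zero_mul]

/-- `Im w₀ = √ε`. [folklore] -/
theorem w₀_im (ε : ℝ) : (w₀ ε).im = Real.sqrt ε := by simp [w₀]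

/-! ### The Jensen data of `a_ε` -/

/-- **Shift-uniform hyperbolicity up to degree `1/ε`:** for `d ε ≤ 1` and EVERY `n`, `J^{d,n}_{a_ε}`
is hyperbolic (zeros of `F_ε` in the convex cone of half-opening `arctan √ε`; Kim–Lee / Obreschkoff,
the tree's `splits_jensenPoly_taylor_of_zeros_mem_convex`). [cite: KimLee2021, Theorem 4 and Remark] -/
theorem splits_jensenPoly_aSeq {ε : ℝ} (hε : 0 < ε) {d : ℕ} (hd : (d : ℝ) * ε ≤ 1) (n : ℕ) :
    (jensenPoly (aSeq ε) d n).Splits := by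
  rw [← taylorSeq_F_eq]
  refine splits_jensenPoly_taylor_of_zeros_mem_convex (isEntireOfOrderLtOne_F ε) (F_conj ε)
    (F_zero_ne hε.le) (convex_negCone (Real.sqrt ε)) (negCone_subset_sector (Real.sqrt_nonneg ε))
    (fun z hz => mem_cone_of_F_eq_zero hε hz) ?_ n
  rwa [Real.sq_sqrt hε.le]

/-- **… but not all `J^{d,0}_{a_ε}` are hyperbolic** (`F_ε(-1 + i√ε) = 0` and Hurwitz /
Pólya–Schur, the tree's `im_eq_zero_of_forall_splits_jensenPoly`). [cite: CravenCsordas1989, §1 (i) and Lemma 2.2] -/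
theorem not_forall_splits_jensenPoly_aSeq {ε : ℝ} (hε : 0 < ε) :
    ¬ ∀ d : ℕ, (jensenPoly (aSeq ε) d 0).Splits := by
  intro h
  have hcoef : ∀ j : ℕ, ((aSeq ε j : ℝ) : ℂ) / (j ! : ℂ) = fCoeff ε j := by
    intro j
    rw [aSeq, fCoeff_eq, Complex.ofReal_mul, Complex.ofReal_natCast, mul_div_cancel_left₀]
    exact_mod_cast j.factorial_ne_zero
  have hF : ∀ w : ℂ, HasSum (fun j => ((aSeq ε j : ℝ) : ℂ) / (j ! : ℂ) * w ^ j) (F ε w) := by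
    intro w; simp only [hcoef]; exact hasSum_fCoeff ε w
  have hsum : ∀ R : ℝ, 0 ≤ R → Summable fun j => |aSeq ε j| / (j ! : ℝ) * R ^ j := by
    intro R _
    have h1 := (hasSum_fCoeff ε R).mapL Complex.reCLM
    refine h1.summable.congr fun j => ?_
    have hj : (j ! : ℝ) ≠ 0 := by positivity
    simp only [Complex.reCLM_apply]
    rw [fCoeff_eq, ← Complex.ofReal_pow, ← Complex.ofReal_mul, Complex.ofReal_re, aSeq, abs_mul,
      abs_of_pos (fCoeffR_pos hε.le j), Nat.abs_cast]
    field_simp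
  have him := im_eq_zero_of_forall_splits_jensenPoly hsum hF (differentiable_F ε) (F_zero_ne hε.le)
    h (F_w₀ hε.le)
  rw [w₀_im] at him
  exact (Real.sqrt_pos.2 hε).ne' him

/-! ### A general form of GORZ §5.1, Steps C–E: factorial-type log-ratios with a negligible
perturbation have the expansion (15) for every degree -/

section Pipeline

open Literature.NumberTheory.LFunctions.GORZAsymp

variable {a : ℕ → ℝ} {L : ℕ → ℝ} {E : ℕ → ℕ → ℝ[X]}

/-- The negligible part `Q^{(d)}_n = L_d(E_d)_n - W^{(d)}_n` of the expansion. [folklore] -/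
def qPoly (E : ℕ → ℕ → ℝ[X]) (d n : ℕ) : ℝ[X] := logPoly d (E d) n - Wpoly d n

/-- `Q^{(d)}` is a negligible family. [folklore] -/
theorem isNegl_qPoly (hE : ∀ d, IsNegl (E d)) (d : ℕ) : IsNegl (qPoly E d) :=
  ((hE d).logPoly d).sub (isNegl_Wpoly d)

/-- The main linear coefficient `A₀(n) = L(n) - log(n + ½) + y(n)/2`. [folklore] -/
def aZero (L : ℕ → ℝ) (n : ℕ) : ℝ := L n - Real.log ((n : ℝ) + 1 / 2) + yseq n / 2

/-- Step D in general: if `log(a(n+j)/a(n)) = L(n) j - ∑_{k<j} log(n+k+½) + log(1 + E^{(d)}_n(j))`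
for large `n`, with `E^{(d)}` negligible, then
`log(a(n+j)/a(n)) = A₀(n) j - (y(n)/2) j² + Q^{(d)}_n(j) + o(δ₀^d)`. [cite: GORZPNAS2019, §5.1] -/
theorem logRatio_sub_isLittleO_gen (hE : ∀ d, IsNegl (E d))
    (h : ∀ d j : ℕ, j ≤ d → ∀ᶠ n in atTop, Real.log (a (n + j) / a n) =
        L n * j - ∑ k ∈ range j, Real.log ((n : ℝ) + k + 1 / 2) +
          Real.log (1 + ((E d) n).eval (j : ℝ)))
    {d : ℕ} (hd : 1 ≤ d) {j : ℕ} (hj : j ≤ d) :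
    (fun n ↦ Real.log (a (n + j) / a n) -
        (aZero L n * j - yseq n / 2 * (j : ℝ) ^ 2 + (qPoly E d n).eval (j : ℝ))) =o[atTop]
      fun n ↦ δ₀ n ^ d := by
  have h1 := isLittleO_log_one_add_sub_logPoly (hE d) d (j : ℝ)
  have h2 := isLittleO_sum_log_sub hd j
  have hident : ∀ᶠ n in atTop,
      (Real.log (1 + ((E d) n).eval (j : ℝ)) - (logPoly d (E d) n).eval (j : ℝ)) -
      (∑ k ∈ range j, Real.log (1 + k * yseq n) -
        (yseq n / 2 * ((j : ℝ) ^ 2 - j) + (Wpoly d n).eval (j : ℝ))) =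
      Real.log (a (n + j) / a n) -
        (aZero L n * j - yseq n / 2 * (j : ℝ) ^ 2 + (qPoly E d n).eval (j : ℝ)) := by
    filter_upwards [h d j hj] with n hn
    rw [hn, sum_log_eq, qPoly, eval_sub, aZero]
    ring
  exact ((h1.trans_isBigO (isBigO_δ₀_pow_of_le (Nat.le_succ d))).sub h2).congr' hident
    EventuallyEq.rfl

/-- The coefficients `c_i(n)` of `Q^{(d)}_n`. [folklore] -/
def cq (E : ℕ → ℕ → ℝ[X]) (d i n : ℕ) : ℝ := (qPoly E d n).coeff i

/-- `c_i(n) = o(δ₀(n)^i)`. [folklore] -/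
theorem isLittleO_cq (hE : ∀ d, IsNegl (E d)) (d i : ℕ) :
    (fun n ↦ cq E d i n) =o[atTop] fun n ↦ δ₀ n ^ i :=
  (isNegl_qPoly hE d).2.1 i

/-- `δ(n) = √(y(n)/2 - c₂(n))`. [folklore] -/
def δq (E : ℕ → ℕ → ℝ[X]) (d n : ℕ) : ℝ := Real.sqrt (yseq n / 2 - cq E d 2 n)

/-- Eventually `y(n)/2 - c₂(n) ≥ δ₀(n)²/4 > 0`. [folklore] -/
theorem eventually_radicand_gen (hE : ∀ d, IsNegl (E d)) (d : ℕ) :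
    ∀ᶠ n in atTop, δ₀ n ^ 2 / 4 ≤ yseq n / 2 - cq E d 2 n := by
  have h := (isLittleO_cq hE d 2).def (c := 1 / 4) (by norm_num)
  filter_upwards [h, eventually_ge_atTop 1] with n hn hn1
  rw [Real.norm_eq_abs, Real.norm_eq_abs, abs_of_nonneg (pow_nonneg (δ₀_nonneg n) 2)] at hn
  have h1 := half_δ₀_sq_le hn1
  have h2 := (abs_le.1 hn).2
  linarith

/-- Eventually `δ(n)² = y(n)/2 - c₂(n)`. [folklore] -/
theorem eventually_δq_sq (hE : ∀ d, IsNegl (E d)) (d : ℕ) :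
    ∀ᶠ n in atTop, δq E d n ^ 2 = yseq n / 2 - cq E d 2 n := by
  filter_upwards [eventually_radicand_gen hE d] with n hn
  exact Real.sq_sqrt (le_trans (by positivity) hn)

/-- Eventually `δ₀(n) ≤ 2δ(n)`. [folklore] -/
theorem eventually_δ₀_le_two_mul_δq (hE : ∀ d, IsNegl (E d)) (d : ℕ) :
    ∀ᶠ n in atTop, δ₀ n ≤ 2 * δq E d n := by
  filter_upwards [eventually_radicand_gen hE d] with n hn
  have h : (δ₀ n / 2) ^ 2 ≤ yseq n / 2 - cq E d 2 n := by
    rw [div_pow]; norm_num; linarith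
  calc δ₀ n = 2 * Real.sqrt ((δ₀ n / 2) ^ 2) := by
        rw [Real.sqrt_sq (by have := δ₀_nonneg n; positivity)]; ring
    _ ≤ 2 * δq E d n := by
        unfold δq
        exact mul_le_mul_of_nonneg_left (Real.sqrt_le_sqrt h) (by norm_num)

/-- Eventually `δ(n) > 0`. [folklore] -/
theorem eventually_δq_pos (hE : ∀ d, IsNegl (E d)) (d : ℕ) : ∀ᶠ n in atTop, 0 < δq E d n := by
  filter_upwards [eventually_δ₀_le_two_mul_δq hE d, eventually_δ₀_pos] with n h1 h2
  linarith

/-- `δ(n) → 0`. [folklore] -/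
theorem tendsto_δq (hE : ∀ d, IsNegl (E d)) (d : ℕ) : Tendsto (δq E d) atTop (𝓝 0) := by
  have hc : Tendsto (cq E d 2) atTop (𝓝 0) :=
    (isLittleO_cq hE d 2).trans_tendsto (by simpa using tendsto_δ₀.pow 2)
  have h1 : Tendsto (fun n ↦ yseq n / 2 - cq E d 2 n) atTop (𝓝 0) := by
    simpa using (tendsto_yseq.div_const 2).sub hc
  have h2 := h1.sqrt
  rw [Real.sqrt_zero] at h2
  exact h2

/-- `δ₀(n)^i = O(δ(n)^i)`. [folklore] -/
theorem isBigO_δ₀_pow_δq_pow (hE : ∀ d, IsNegl (E d)) (d i : ℕ) :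
    (fun n ↦ δ₀ n ^ i) =O[atTop] fun n ↦ δq E d n ^ i := by
  refine IsBigO.of_bound (2 ^ i) ?_
  filter_upwards [eventually_δ₀_le_two_mul_δq hE d, eventually_δq_pos hE d] with n h1 h2
  rw [Real.norm_eq_abs, Real.norm_eq_abs, abs_of_nonneg (pow_nonneg (δ₀_nonneg n) i),
    abs_of_nonneg (pow_nonneg h2.le i), ← mul_pow]
  exact pow_le_pow_left₀ (δ₀_nonneg n) h1 i

/-- Step E in general, degrees `d ≥ 2`. [cite: GORZPNAS2019, §5.1 eq. (15)] -/
theorem gorzExpansion_of_two_le_gen (hE : ∀ d, IsNegl (E d))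
    (h : ∀ d j : ℕ, j ≤ d → ∀ᶠ n in atTop, Real.log (a (n + j) / a n) =
        L n * j - ∑ k ∈ range j, Real.log ((n : ℝ) + k + 1 / 2) +
          Real.log (1 + ((E d) n).eval (j : ℝ)))
    {d : ℕ} (hd : 2 ≤ d) :
    ∃ (A δ : ℕ → ℝ) (g : ℕ → ℕ → ℝ),
    (∀ᶠ n in atTop, 0 < δ n) ∧ Tendsto δ atTop (𝓝 0) ∧
    (∀ i, 3 ≤ i → i ≤ d → (g i) =o[atTop] fun n ↦ δ n ^ i) ∧
    ∀ j : ℕ, j ≤ d → (fun n ↦ Real.log (a (n + j) / a n) -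
        (A n * j - δ n ^ 2 * (j : ℝ) ^ 2 + ∑ i ∈ Icc 3 d, g i n * (j : ℝ) ^ i)) =o[atTop]
        fun n ↦ δ n ^ d := by
  refine ⟨fun n ↦ aZero L n + cq E d 1 n, δq E d, fun i n ↦ cq E d i n, eventually_δq_pos hE d,
    tendsto_δq hE d, fun i _ _ ↦ (isLittleO_cq hE d i).trans_isBigO (isBigO_δ₀_pow_δq_pow hE d i),
    fun j hj ↦ ?_⟩
  have hd1 : 1 ≤ d := by omega
  have hmain := logRatio_sub_isLittleO_gen hE h hd1 hj
  have htail := (isNegl_qPoly hE d).isLittleO_eval_sub_sum (j : ℝ) d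
  have hev : ∀ᶠ n in atTop,
      (Real.log (a (n + j) / a n) -
        (aZero L n * j - yseq n / 2 * (j : ℝ) ^ 2 + (qPoly E d n).eval (j : ℝ))) +
      ((qPoly E d n).eval (j : ℝ) - ∑ i ∈ Icc 1 d, (qPoly E d n).coeff i * (j : ℝ) ^ i) =
      Real.log (a (n + j) / a n) -
      ((aZero L n + cq E d 1 n) * j - δq E d n ^ 2 * (j : ℝ) ^ 2 +
        ∑ i ∈ Icc 3 d, cq E d i n * (j : ℝ) ^ i) := by
    filter_upwards [eventually_δq_sq hE d] with n hn
    have hsplit : ∑ i ∈ Icc 1 d, (qPoly E d n).coeff i * (j : ℝ) ^ i =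
        cq E d 1 n * j + cq E d 2 n * (j : ℝ) ^ 2 + ∑ i ∈ Icc 3 d, cq E d i n * (j : ℝ) ^ i := by
      rw [← Finset.insert_Icc_add_one_left_eq_Icc (by omega : 1 ≤ d), sum_insert (by simp),
        show (1 : ℕ) + 1 = 2 from rfl,
        ← Finset.insert_Icc_add_one_left_eq_Icc (by omega : 2 ≤ d), sum_insert (by simp)]
      simp only [cq, pow_one]
      ring
    rw [hsplit, hn]
    ring
  exact ((hmain.add htail).congr' hev (Eventually.of_forall fun _ ↦ rfl)).trans_isBigO
    (isBigO_δ₀_pow_δq_pow hE d d)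

/-- **GORZ §5.1 Steps C–E in general:** a sequence `a` whose log-ratios have the factorial form
`log(a(n+j)/a(n)) = L(n) j - ∑_{k<j} log(n + k + ½) + log(1 + E^{(d)}_n(j))` (`j ≤ d`, `n` large),
with negligible polynomial families `E^{(d)}`, is in the Hermite-universality class for every degree
(`HasGORZExpansion a`). For `a = γ`, `L(n) = 2 log ū_{2n}` and `E` comes from the moments of `Φ`
(`JensenAsymptotics.lean`); below it is applied with `L = -log 4` and a rational `E`.
[cite: GORZPNAS2019, §5.1 eq. (15)] -/
theorem hasGORZExpansion_of_factorialLogRatio (hE : ∀ d, IsNegl (E d))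
    (h : ∀ d j : ℕ, j ≤ d → ∀ᶠ n in atTop, Real.log (a (n + j) / a n) =
        L n * j - ∑ k ∈ range j, Real.log ((n : ℝ) + k + 1 / 2) +
          Real.log (1 + ((E d) n).eval (j : ℝ))) :
    HasGORZExpansion a := by
  intro d hd
  rcases le_or_gt 2 d with hd2 | hd2
  · exact gorzExpansion_of_two_le_gen hE h hd2
  · obtain rfl : d = 1 := by omega
    obtain ⟨A, δ, g, h1, h2, h3, h4⟩ := gorzExpansion_of_two_le_gen hE h (le_refl 2)
    refine ⟨A, δ, g, h1, h2, fun i hi hi' ↦ by omega, fun j hj ↦ ?_⟩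
    have h := h4 j (by omega)
    have hI : Icc 3 2 = (∅ : Finset ℕ) := by decide
    have hI' : Icc 3 1 = (∅ : Finset ℕ) := by decide
    simp only [hI, sum_empty] at h
    simp only [hI', sum_empty]
    refine h.trans_isBigO (IsBigO.of_bound' ?_)
    have hsmall : ∀ᶠ n in atTop, |δ n| ≤ 1 := by
      have := Metric.tendsto_nhds.1 h2 1 one_pos
      exact this.mono fun n hn ↦ by rw [Real.dist_0_eq_abs] at hn; exact hn.le
    filter_upwards [hsmall] with n hn
    rw [Real.norm_eq_abs, Real.norm_eq_abs, abs_pow, abs_pow, pow_one]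
    exact pow_le_of_le_one (abs_nonneg _) hn two_ne_zero

end Pipeline

/-! ### The Taylor sequence `a_ε` in closed form -/

section ClosedForm

open Literature.NumberTheory.LFunctions.GORZAsymp

/-- `b(m) = m!/(2m)!`, the Taylor sequence of `G` (`G⁽ᵐ⁾(0) = m! g_m`). [folklore] -/
def bSeq (m : ℕ) : ℝ := (m ! : ℝ) / ((2 * m)! : ℝ)

/-- `b(m) > 0`. [folklore] -/
theorem bSeq_pos (m : ℕ) : 0 < bSeq m := by unfold bSeq; positivity

/-- `b(m+1) = b(m) / (4(m + ½))`. [folklore] -/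
theorem bSeq_succ (m : ℕ) : bSeq (m + 1) = bSeq m / (4 * ((m : ℝ) + 1 / 2)) := by
  unfold bSeq
  rw [show 2 * (m + 1) = (2 * m + 1) + 1 by ring, Nat.factorial_succ (2 * m + 1),
    Nat.factorial_succ (2 * m), Nat.factorial_succ m]
  push_cast
  have h1 : ((2 * m)! : ℝ) ≠ 0 := by positivity
  have h2 : (m ! : ℝ) ≠ 0 := by positivity
  field_simp
  ring

/-- `log(b(n+j)/b(n)) = -j log 4 - ∑_{k<j} log(n + k + ½)`. [folklore] -/
theorem log_bSeq_ratio (n j : ℕ) : Real.log (bSeq (n + j) / bSeq n) =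
    -(Real.log 4 * j) - ∑ k ∈ range j, Real.log ((n : ℝ) + k + 1 / 2) := by
  induction j with
  | zero => simp [div_self (bSeq_pos n).ne']
  | succ j ih =>
    rw [show n + (j + 1) = (n + j) + 1 by ring, bSeq_succ, sum_range_succ, div_right_comm,
      Real.log_div (div_pos (bSeq_pos _) (bSeq_pos _)).ne' (by positivity), ih,
      Real.log_mul (by norm_num) (by positivity)]
    push_cast; ring

/-- The quartic `ρ_ε = 16X⁴ - 48X³ + 52X² - 16X + 1 + ε`. [folklore] -/
def ρP (ε : ℝ) : ℝ[X] := C 16 * X ^ 4 - C 48 * X ^ 3 + C 52 * X ^ 2 - C 16 * X + C (1 + ε)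

/-- `ρ_ε(x) = 16x⁴ - 48x³ + 52x² - 16x + 1 + ε` (so that `a_ε(m) = b(m) ρ_ε(m)`). [folklore] -/
def ρ (ε x : ℝ) : ℝ := (ρP ε).eval x

/-- Auxiliary: `ρ_eq`. [folklore] -/
theorem ρ_eq (ε x : ℝ) : ρ ε x = 16 * x ^ 4 - 48 * x ^ 3 + 52 * x ^ 2 - 16 * x + (1 + ε) := by
  simp [ρ, ρP]

/-- `ρ_ε(n) = (4n² - 6n + 1)² + 4n(2n - 1) + ε > 0` on `ℕ`. [folklore] -/
theorem ρ_pos {ε : ℝ} (hε : 0 < ε) (n : ℕ) : 0 < ρ ε n := by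
  rw [ρ_eq]
  have h : (0 : ℝ) ≤ 4 * n * (2 * n - 1) := by
    rcases Nat.eq_zero_or_pos n with rfl | hn
    · simp
    · have h1 : (1 : ℝ) ≤ n := by exact_mod_cast hn
      exact mul_nonneg (by positivity) (by linarith)
  nlinarith [sq_nonneg (4 * (n : ℝ) ^ 2 - 6 * n + 1)]

/-- `n⁴ ≤ ρ_ε(n)` for `n ≥ 1`. [folklore] -/
theorem pow_four_le_ρ {ε : ℝ} (hε : 0 < ε) {n : ℕ} (hn : 1 ≤ n) : (n : ℝ) ^ 4 ≤ ρ ε n := by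
  rw [ρ_eq]
  have hn1 : (1 : ℝ) ≤ n := by exact_mod_cast hn
  obtain ⟨t, ht, hnt⟩ : ∃ t : ℝ, 0 ≤ t ∧ (n : ℝ) = 1 + t := ⟨(n : ℝ) - 1, by linarith, by ring⟩
  rw [hnt]
  nlinarith [mul_nonneg ht (sq_nonneg (t - 1)), pow_nonneg ht 3, pow_nonneg ht 4, sq_nonneg t]

/-- **Closed form:** `a_ε(m) = b(m) ρ_ε(m)`, i.e.
`m!·((1+ε) g_m + 2 g_{m-1} + g_{m-2}) = m!/(2m)! · (1 + ε + 2(2m)(2m-1) + (2m)(2m-1)(2m-2)(2m-3))`.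
[folklore] -/
theorem aSeq_eq (ε : ℝ) (m : ℕ) : aSeq ε m = bSeq m * ρ ε m := by
  rw [ρ_eq, aSeq, fCoeffR, bSeq]
  rcases m with _ | _ | k
  · simp [coshCoeffR]
  · simp [coshCoeffR]
    norm_num [Nat.factorial]
    ring
  · have hk1 : k + 2 ≠ 0 := by omega
    have hk2 : ¬ (k + 2 < 2) := by omega
    simp only [hk1, if_false, hk2, show k + 2 - 1 = k + 1 by omega, show k + 2 - 2 = k by omega,
      coshCoeffR]
    have h1 : ((2 * (k + 2))! : ℝ) = (2 * k + 4) * (2 * k + 3) * ((2 * k + 2) * (2 * k + 1) * (2 * k)!) := by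
      rw [show 2 * (k + 2) = (2 * k + 3) + 1 by ring, Nat.factorial_succ (2 * k + 3),
        show 2 * k + 3 = (2 * k + 2) + 1 by ring, Nat.factorial_succ (2 * k + 2),
        show 2 * k + 2 = (2 * k + 1) + 1 by ring, Nat.factorial_succ (2 * k + 1),
        Nat.factorial_succ (2 * k)]
      push_cast; ring
    have h2 : ((2 * (k + 1))! : ℝ) = (2 * k + 2) * (2 * k + 1) * (2 * k)! := by
      rw [show 2 * (k + 1) = (2 * k + 1) + 1 by ring, Nat.factorial_succ (2 * k + 1),
        Nat.factorial_succ (2 * k)]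
      push_cast; ring
    rw [h1, h2]
    have h3 : ((2 * k)! : ℝ) ≠ 0 := by positivity
    push_cast
    field_simp
    ring

/-- `log(a_ε(n+j)/a_ε(n)) = -j log 4 - ∑_{k<j} log(n+k+½) + log(ρ_ε(n+j)/ρ_ε(n))`. [folklore] -/
theorem log_aSeq_ratio {ε : ℝ} (hε : 0 < ε) (n j : ℕ) :
    Real.log (aSeq ε (n + j) / aSeq ε n) =
      -(Real.log 4 * j) - ∑ k ∈ range j, Real.log ((n : ℝ) + k + 1 / 2) +
        Real.log (ρ ε (n + j : ℕ) / ρ ε n) := by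
  rw [aSeq_eq, aSeq_eq, mul_div_mul_comm, Real.log_mul (div_pos (bSeq_pos _) (bSeq_pos _)).ne'
    (div_pos (ρ_pos hε _) (ρ_pos hε _)).ne', log_bSeq_ratio]

end ClosedForm

/-! ### The rational perturbation `E_n(j) = (ρ_ε(n+j) - ρ_ε(n))/ρ_ε(n)` is negligible -/

section Negligible

open Literature.NumberTheory.LFunctions.GORZAsymp

/-- `E_n = ρ_ε(n)⁻¹ (ρ_ε(X + n) - ρ_ε(n))`. [folklore] -/
def Eρ (ε : ℝ) (n : ℕ) : ℝ[X] := C (ρ ε n)⁻¹ * ((ρP ε).comp (X + C (n : ℝ)) - C (ρ ε n))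

/-- `E_n(x) = (ρ_ε(n+x) - ρ_ε(n))/ρ_ε(n)`. [folklore] -/
theorem eval_Eρ (ε : ℝ) (n : ℕ) (x : ℝ) : (Eρ ε n).eval x = (ρ ε (n + x) - ρ ε n) / ρ ε n := by
  simp only [Eρ, ρ, eval_mul, eval_C, eval_sub, eval_comp, eval_add, eval_X]
  rw [add_comm x]; ring

/-- `1 + E_n(j) = ρ_ε(n+j)/ρ_ε(n)`. [folklore] -/
theorem one_add_eval_Eρ {ε : ℝ} (hε : 0 < ε) (n j : ℕ) :
    1 + (Eρ ε n).eval (j : ℝ) = ρ ε (n + j : ℕ) / ρ ε n := by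
  rw [eval_Eρ, Nat.cast_add]
  field_simp [(ρ_pos hε n).ne']
  ring

/-- `ρ_ε(X + t)` expanded in powers of `X`. [folklore] -/
theorem comp_ρP (ε t : ℝ) : (ρP ε).comp (X + C t) =
    C (16 : ℝ) * X ^ 4 + C (64 * t - 48) * X ^ 3 + C (96 * t ^ 2 - 144 * t + 52) * X ^ 2 +
      C (64 * t ^ 3 - 144 * t ^ 2 + 104 * t - 16) * X + C (ρ ε t) := by
  apply Polynomial.funext
  intro x
  simp only [ρP, ρ, eval_comp, eval_add, eval_sub, eval_mul, eval_C, eval_pow, eval_X]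
  ring

/-- `E_n` has no constant term. [folklore] -/
theorem coeff_Eρ_zero (ε : ℝ) (n : ℕ) : (Eρ ε n).coeff 0 = 0 := by
  rw [Eρ, comp_ρP, coeff_C_mul, coeff_sub]
  simp only [coeff_add, coeff_C_mul, coeff_X_pow, coeff_X, coeff_C]
  norm_num

/-- Coefficient of `j` in `E_n`: `(64n³ - 144n² + 104n - 16)/ρ_ε(n)`. [folklore] -/
theorem coeff_Eρ_one (ε : ℝ) (n : ℕ) : (Eρ ε n).coeff 1 =
    (ρ ε n)⁻¹ * (64 * (n : ℝ) ^ 3 - 144 * (n : ℝ) ^ 2 + 104 * n - 16) := by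
  rw [Eρ, comp_ρP, coeff_C_mul, coeff_sub]
  congr 1
  simp only [coeff_add, coeff_C_mul, coeff_X_pow, coeff_X, coeff_C]
  norm_num

/-- Coefficient of `j²` in `E_n`: `(96n² - 144n + 52)/ρ_ε(n)`. [folklore] -/
theorem coeff_Eρ_two (ε : ℝ) (n : ℕ) : (Eρ ε n).coeff 2 =
    (ρ ε n)⁻¹ * (96 * (n : ℝ) ^ 2 - 144 * n + 52) := by
  rw [Eρ, comp_ρP, coeff_C_mul, coeff_sub]
  congr 1
  simp only [coeff_add, coeff_C_mul, coeff_X_pow, coeff_X, coeff_C]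
  norm_num

/-- Coefficient of `j³` in `E_n`: `(64n - 48)/ρ_ε(n)`. [folklore] -/
theorem coeff_Eρ_three (ε : ℝ) (n : ℕ) : (Eρ ε n).coeff 3 = (ρ ε n)⁻¹ * (64 * (n : ℝ) - 48) := by
  rw [Eρ, comp_ρP, coeff_C_mul, coeff_sub]
  congr 1
  simp only [coeff_add, coeff_C_mul, coeff_X_pow, coeff_X, coeff_C]
  norm_num

/-- Coefficient of `j⁴` in `E_n`: `16/ρ_ε(n)`. [folklore] -/
theorem coeff_Eρ_four (ε : ℝ) (n : ℕ) : (Eρ ε n).coeff 4 = (ρ ε n)⁻¹ * 16 := by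
  rw [Eρ, comp_ρP, coeff_C_mul, coeff_sub]
  congr 1
  simp only [coeff_add, coeff_C_mul, coeff_X_pow, coeff_X, coeff_C]
  norm_num

/-- `E_n` has degree `≤ 4`: higher coefficients vanish. [folklore] -/
theorem coeff_Eρ_of_four_lt (ε : ℝ) (n : ℕ) {i : ℕ} (hi : 4 < i) : (Eρ ε n).coeff i = 0 := by
  rw [Eρ, comp_ρP, coeff_C_mul, coeff_sub]
  have h4 : i ≠ 4 := by omega
  have h3 : i ≠ 3 := by omega
  have h2 : i ≠ 2 := by omega
  have h1 : (1 : ℕ) ≠ i := by omega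
  have h0 : i ≠ 0 := by omega
  simp only [coeff_add, coeff_C_mul, coeff_X_pow, coeff_X, coeff_C, if_neg h4, if_neg h3, if_neg h2,
    if_neg h1, if_neg h0]
  norm_num

/-- `deg E_n ≤ 4`. [folklore] -/
theorem natDegree_Eρ_le (ε : ℝ) (n : ℕ) : (Eρ ε n).natDegree ≤ 4 := by
  rw [natDegree_le_iff_coeff_eq_zero]
  intro N hN
  exact_mod_cast coeff_Eρ_of_four_lt ε n (by exact_mod_cast hN)

/-- A bound `(2n)ⁱ |f(n)| ≤ K` (`n ≥ 1`) gives `f = O(δ₀^{2i}) = o(δ₀ⁱ)` for `i ≥ 1`. [folklore] -/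
theorem isLittleO_of_mul_pow_le {f : ℕ → ℝ} {i : ℕ} (hi : 1 ≤ i) (K : ℝ)
    (h : ∀ n : ℕ, 1 ≤ n → (2 * (n : ℝ)) ^ i * |f n| ≤ K) :
    f =o[atTop] fun n ↦ δ₀ n ^ i := by
  have hO : f =O[atTop] fun n ↦ δ₀ n ^ (2 * i) := by
    refine IsBigO.of_bound K ?_
    filter_upwards [eventually_ge_atTop 1] with n hn
    have hn1 : (1 : ℝ) ≤ n := by exact_mod_cast hn
    have hn' : (0 : ℝ) < 2 * n := by linarith
    have h0 : (0 : ℝ) ≤ 1 / (2 * n) := by positivity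
    rw [Real.norm_eq_abs, Real.norm_eq_abs, pow_mul, δ₀_sq hn, abs_of_nonneg (pow_nonneg h0 i),
      one_div, inv_pow, le_mul_inv_iff₀ (pow_pos hn' i)]
    exact (mul_comm _ _).trans_le (h n hn)
  exact hO.trans_isLittleO (isLittleO_δ₀_pow_of_lt (by omega))

/-- `P(n)/ρ_ε(n) = o(δ₀ⁱ)` as soon as `(2n)ⁱ|P(n)| ≤ K n⁴` (`ρ_ε(n) ≥ n⁴`). [folklore] -/
theorem isLittleO_inv_ρ_mul {ε : ℝ} (hε : 0 < ε) {i : ℕ} (P : ℕ → ℝ) (K : ℝ) (hi : 1 ≤ i)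
    (hP : ∀ n : ℕ, 1 ≤ n → (2 * (n : ℝ)) ^ i * |P n| ≤ K * (n : ℝ) ^ 4) :
    (fun n : ℕ ↦ (ρ ε n)⁻¹ * P n) =o[atTop] fun n ↦ δ₀ n ^ i := by
  refine isLittleO_of_mul_pow_le hi (max K 0) fun n hn ↦ ?_
  have hρ := ρ_pos hε n
  have h4 := pow_four_le_ρ hε hn
  rw [abs_mul, abs_inv, abs_of_pos hρ, mul_left_comm, inv_mul_le_iff₀ hρ]
  calc (2 * (n : ℝ)) ^ i * |P n| ≤ K * (n : ℝ) ^ 4 := hP n hn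
    _ ≤ max K 0 * (n : ℝ) ^ 4 := by gcongr; exact le_max_left _ _
    _ ≤ max K 0 * ρ ε n := by gcongr
    _ = ρ ε n * max K 0 := mul_comm _ _

/-- Every coefficient of `E_n` is `o(δ₀(n)^i)` (`i`-th coefficient `= O(n^{-i})`). [folklore] -/
theorem isLittleO_coeff_Eρ {ε : ℝ} (hε : 0 < ε) (i : ℕ) :
    (fun n ↦ (Eρ ε n).coeff i) =o[atTop] fun n ↦ δ₀ n ^ i := by
  rcases i with _ | _ | _ | _ | _ | i
  · simp only [coeff_Eρ_zero]; exact isLittleO_zero _ _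
  · have hf : (fun n ↦ (Eρ ε n).coeff (0 + 1)) = fun n : ℕ ↦
        (ρ ε n)⁻¹ * (64 * (n : ℝ) ^ 3 - 144 * (n : ℝ) ^ 2 + 104 * n - 16) :=
      funext fun n ↦ coeff_Eρ_one ε n
    rw [hf]
    refine isLittleO_inv_ρ_mul hε _ 656 le_rfl fun n hn ↦ ?_
    have h1 : (1 : ℝ) ≤ n := by exact_mod_cast hn
    have h0 : (0 : ℝ) ≤ n := by linarith
    have hP : |64 * (n : ℝ) ^ 3 - 144 * (n : ℝ) ^ 2 + 104 * n - 16| ≤ 328 * (n : ℝ) ^ 3 := by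
      rw [abs_le]; constructor <;> nlinarith [pow_nonneg h0 2, pow_nonneg h0 3]
    calc (2 * (n : ℝ)) ^ (0 + 1) * |64 * (n : ℝ) ^ 3 - 144 * (n : ℝ) ^ 2 + 104 * n - 16|
        ≤ (2 * n) * (328 * (n : ℝ) ^ 3) := by rw [zero_add, pow_one]; gcongr
      _ = 656 * (n : ℝ) ^ 4 := by ring
  · have hf : (fun n ↦ (Eρ ε n).coeff (1 + 1)) = fun n : ℕ ↦
        (ρ ε n)⁻¹ * (96 * (n : ℝ) ^ 2 - 144 * n + 52) :=
      funext fun n ↦ coeff_Eρ_two ε n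
    rw [hf]
    refine isLittleO_inv_ρ_mul hε _ 1168 (by norm_num) fun n hn ↦ ?_
    have h1 : (1 : ℝ) ≤ n := by exact_mod_cast hn
    have hP : |96 * (n : ℝ) ^ 2 - 144 * n + 52| ≤ 292 * (n : ℝ) ^ 2 := by
      rw [abs_le]; constructor <;> nlinarith
    calc (2 * (n : ℝ)) ^ (1 + 1) * |96 * (n : ℝ) ^ 2 - 144 * n + 52|
        ≤ (2 * (n : ℝ)) ^ (1 + 1) * (292 * (n : ℝ) ^ 2) := by gcongr
      _ = 1168 * (n : ℝ) ^ 4 := by ring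
  · have hf : (fun n ↦ (Eρ ε n).coeff (2 + 1)) = fun n : ℕ ↦ (ρ ε n)⁻¹ * (64 * (n : ℝ) - 48) :=
      funext fun n ↦ coeff_Eρ_three ε n
    rw [hf]
    refine isLittleO_inv_ρ_mul hε _ 896 (by norm_num) fun n hn ↦ ?_
    have h1 : (1 : ℝ) ≤ n := by exact_mod_cast hn
    have hP : |64 * (n : ℝ) - 48| ≤ 112 * n := by
      rw [abs_le]; constructor <;> nlinarith
    calc (2 * (n : ℝ)) ^ (2 + 1) * |64 * (n : ℝ) - 48|
        ≤ (2 * (n : ℝ)) ^ (2 + 1) * (112 * n) := by gcongr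
      _ = 896 * (n : ℝ) ^ 4 := by ring
  · have hf : (fun n ↦ (Eρ ε n).coeff (3 + 1)) = fun n : ℕ ↦ (ρ ε n)⁻¹ * 16 :=
      funext fun n ↦ coeff_Eρ_four ε n
    rw [hf]
    refine isLittleO_inv_ρ_mul hε _ 256 (by norm_num) fun n hn ↦ le_of_eq ?_
    rw [show |(16 : ℝ)| = 16 by norm_num]; ring
  · have : (fun n ↦ (Eρ ε n).coeff (i + 5)) = fun _ ↦ 0 :=
      funext fun n ↦ coeff_Eρ_of_four_lt ε n (by omega)
    rw [this]; exact isLittleO_zero _ _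

/-- The perturbation family `E` is negligible at scale `δ₀`. [folklore] -/
theorem isNegl_Eρ {ε : ℝ} (hε : 0 < ε) : IsNegl (Eρ ε) :=
  ⟨⟨4, natDegree_Eρ_le ε⟩, isLittleO_coeff_Eρ hε, coeff_Eρ_zero ε⟩

/-- **`a_ε` is in the Hermite-universality class for every degree** (GORZ §5.1 (15) holds for it).
[cite: GORZPNAS2019, §5.1 eq. (15)] -/
theorem hasGORZExpansion_aSeq {ε : ℝ} (hε : 0 < ε) : HasGORZExpansion (aSeq ε) := by
  refine hasGORZExpansion_of_factorialLogRatio (L := fun _ => -Real.log 4)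
    (E := fun _ n => Eρ ε n) (fun _ => isNegl_Eρ hε) fun d j _ => Eventually.of_forall fun n => ?_
  rw [log_aSeq_ratio hε, one_add_eval_Eρ hε]
  ring

end Negligible

end ConeWitness

open ConeWitness

/-- **Barrier `JensenPolynomialsShiftUniform` (audit 2026-08-16; Farmer's `X_{10}` phenomenon, proved
with an explicit genus-zero witness).** For every `D ≥ 1` there are a real entire function `F` of
order `< 1` and its Taylor sequence `a(k) = F⁽ᵏ⁾(0) > 0` such that: every zero of `F` lies in the cone
`|Im w| ≤ -Re w/√D` and one of them is non-real ("RH" fails for `F`); `a` satisfies GORZ's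
Hermite-universality hypotheses §5.1 (15) for EVERY degree and is `EventuallyHyperbolic`; `J^{d,n}_a`
is hyperbolic for EVERY shift `n` and every degree `d ≤ D`; and `a` is NOT `AllHyperbolic`. Hence no
combination of (i) Hermite universality for all degrees, (ii) hyperbolicity for all large shifts
(GORZ Thm. 1 shape, any thresholds `N(d)`), (iii) hyperbolicity for ALL shifts up to any fixed
degree `D` (Turán / higher-Turán hierarchies at all shifts, GORZ Thm. 2, Chasse / Kim–Lee from RH up
to a height) implies full hyperbolicity — for `γ` the latter is RH (`polya_jensen`).

BARRIER (structured block, D-0021):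
- technique_class: Jensen-polynomial hyperbolicity data for `γ` of the following three kinds, in any combination: (i) Hermite universality — GORZ §5.1 (15) for every degree (`HasGORZExpansion`), GORZ Thms. 3/6/7 and their derivative-aspect GUE corollaries; (ii) large-shift hyperbolicity `n ≥ N(d)` for each `d` (GORZ Thm. 1 `gorz_eventually`; Griffin–Ono–Rolen–Thorner–Tripp–Wagner; Holland 2026; O'Sullivan Thm. 1.3), i.e. `EventuallyHyperbolic`; (iii) shift-UNIFORM hyperbolicity at bounded degree — `J^{d,n}_γ` hyperbolic for all `n` and all `d ≤ D` for a fixed `D` (Csordas–Norfolk–Varga, Dimitrov–Lucas: `d ≤ 3`; GORZ Thm. 2 `gorz_le_eight`; the tree's `jensenPoly_xiTaylorCoeff_splits_of_le`: `d ≤ 64`; Kim–Lee Thm. 4 / Chasse `GORZ2019_chasse`: `4d ≤ T²` from RH to height `T`) [cite: GORZPNAS2019, Thms. 1–3 and §5.1] [cite: Farmer2022, §§2–4] [cite: KimLee2021, Thm. 4 and Remark]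
- blocks: RiemannHypothesis via Pólya's criterion `Literature.NumberTheory.LFunctions.polya_jensen` (`RH ↔ AllHyperbolic xiTaylorCoeff`) from data of kinds (i)–(iii): for every `D` the data hold for the witness sequence `a` while `AllHyperbolic a` fails (this theorem, PROVED: `JensenPolynomialsShiftUniform_holds`) [cite: Farmer2022, §4]
- because: `F_ε = ((w+1)²+ε)·G`, `G(z²) = cosh z`, `ε = 1/D`, is a genus-zero "fake `ξ(½+√w)`" whose zeros lie in the cone of half-opening `arctan √ε` around the negative axis — so Obreschkoff/Kim–Lee give all-shift hyperbolicity for `d ≤ 1/ε` exactly as RH-up-to-height-`T` does for `γ` — whose Taylor sequence `(m!/(2m)!)·ρ_ε(m)` has the same factorial-type log-ratios as `γ` up to a negligible rational perturbation — so GORZ's §5.1 bookkeeping gives (15) for every degree — and which has the non-real zeros `-1 ± i√ε`, so by Pólya–Schur/Hurwitz some `J^{d,0}` is not hyperbolic: "the Jensen polynomials are not efficient at encoding information about zeros" [cite: Farmer2022, §4] [cite: CravenCsordas1989, Lemma 2.2]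
- evasions_known: none published; what is NOT of kinds (i)–(iii): degree-UNIFORM statements at a fixed shift (`J^{d,n}_γ` hyperbolic for all `d` at some `n ≥ 1`, i.e. `F⁽ⁿ⁾` in the Laguerre–Pólya class — implied by RH, open otherwise; Farmer's `X_{10}` suggests even these do not help, not formalised), and arithmetic properties of the actual values `γ(n)` (moment representation `γ(n) = 64·4ⁿ n!/(2n)! ∫₀^∞ Φ u^{2n}`, total positivity of the kernel) beyond their asymptotics [cite: Farmer2022, §4]
- status: established (proved here; standard axioms; no named facts)
- scope_caveats: the degree bound `D` is arbitrary but fixed BEFORE the witness is chosen (the witness depends on `D` through `ε = 1/D`); a single sequence with all-shift hyperbolicity for every degree would be `AllHyperbolic`, which is the statement itself; the theorem says nothing against proving `AllHyperbolic xiTaylorCoeff` by a degree-uniform argument at shift `0`, nor against mechanisms using the specific values of `γ`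

[cite: Farmer2022, §4] [cite: GORZPNAS2019, §5.1 eq. (15)] [cite: KimLee2021, Thm. 4 and Remark] -/
def JensenPolynomialsShiftUniform : Prop :=
  ∀ D : ℕ, 1 ≤ D → ∃ (F : ℂ → ℂ) (a : ℕ → ℝ),
    IsEntireOfOrderLtOne F ∧ (∀ k, a k = (iteratedDeriv k F 0).re) ∧
    (∀ w : ℂ, F w = 0 → |w.im| ≤ -w.re / Real.sqrt D) ∧ (∃ w : ℂ, F w = 0 ∧ w.im ≠ 0) ∧
    (∀ n, 0 < a n) ∧
    HasGORZExpansion a ∧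
    EventuallyHyperbolic a ∧
    (∀ d n : ℕ, d ≤ D → (jensenPoly a d n).Splits) ∧
    ¬ AllHyperbolic a

/-- **The barrier holds**, witnessed by `F_{1/D} = ((w+1)² + 1/D)·G`, `G(z²) = cosh z`.
[cite: Farmer2022, §4] [cite: GORZPNAS2019, §5.1 eq. (15)] [cite: KimLee2021, Thm. 4 and Remark] -/
theorem JensenPolynomialsShiftUniform_holds : JensenPolynomialsShiftUniform := by
  intro D hD
  have hD0 : (0 : ℝ) < D := by exact_mod_cast hD
  set ε : ℝ := 1 / D with hεdef
  have hε : 0 < ε := by positivity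
  have hsq : Real.sqrt ε = 1 / Real.sqrt D := by
    rw [hεdef, Real.sqrt_div' 1 hD0.le] ; simp
  refine ⟨F ε, aSeq ε, isEntireOfOrderLtOne_F ε, fun k => (re_iteratedDeriv_F ε k).symm,
    fun w hw => ?_, ⟨w₀ ε, F_w₀ hε.le, by rw [w₀_im]; exact (Real.sqrt_pos.2 hε).ne'⟩,
    aSeq_pos hε.le, hasGORZExpansion_aSeq hε,
    (hasGORZExpansion_aSeq hε).eventuallyHyperbolic (aSeq_pos hε.le),
    fun d n hd => splits_jensenPoly_aSeq hε ?_ n,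
    fun h => not_forall_splits_jensenPoly_aSeq hε fun d => h d 0⟩
  · obtain ⟨h1, h2⟩ := mem_cone_of_F_eq_zero hε hw
    rw [hsq, one_div_mul_eq_div] at h1 h2
    rw [abs_le, neg_div, neg_neg]
    constructor <;> linarith
  · have : (d : ℝ) ≤ D := by exact_mod_cast hd
    rw [hεdef, mul_one_div, div_le_one hD0]
    exact this

/-- Corollary: **for no `D` does "positivity + universality for all degrees + large-shift
hyperbolicity + all-shift hyperbolicity up to degree `D`" imply full hyperbolicity.**
[cite: Farmer2022, §4] -/
theorem not_allHyperbolic_of_shiftUniform (D : ℕ) :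
    ¬ ∀ a : ℕ → ℝ, (∀ n, 0 < a n) → HasGORZExpansion a → EventuallyHyperbolic a →
      (∀ d n : ℕ, d ≤ D → (jensenPoly a d n).Splits) → AllHyperbolic a := by
  intro h
  obtain ⟨F, a, -, -, -, -, hpos, hG, hE, hD, hnot⟩ := JensenPolynomialsShiftUniform_holds (max D 1)
    (le_max_right _ _)
  exact hnot (h a hpos hG hE fun d n hd => hD d n (hd.trans (le_max_left _ _)))

/-- Corollary in the shape of the tree's facts about `γ`: the conjunction "GORZ (15) for every degree
∧ GORZ Thm. 1 ∧ (GORZ Thm. 2 / Chasse-type) hyperbolicity at all shifts for `d ≤ D`" has a model in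
which Pólya's criterion FAILS — so these theorems about `γ` (`xiTaylorCoeff_logRatio_holds`,
`gorz_eventually_holds`, `jensenPoly_xiTaylorCoeff_splits_of_le`, `GORZ2019_chasse`) cannot by
themselves yield `JensenPolyaCriterion`. [cite: Farmer2022, §4] -/
theorem exists_universal_shiftUniform_not_allHyperbolic (D : ℕ) :
    ∃ a : ℕ → ℝ, (∀ n, 0 < a n) ∧ HasGORZExpansion a ∧ EventuallyHyperbolic a ∧
      (∀ d n : ℕ, d ≤ D → (jensenPoly a d n).Splits) ∧ ¬ AllHyperbolic a := by
  obtain ⟨F, a, -, -, -, -, hpos, hG, hE, hD, hnot⟩ := JensenPolynomialsShiftUniform_holds (max D 1)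
    (le_max_right _ _)
  exact ⟨a, hpos, hG, hE, fun d n hd => hD d n (hd.trans (le_max_left _ _)), hnot⟩

end Literature.Barriers.RiemannHypothesis

end
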